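import Summits.HodgeConjecture.HodgeConjecture.Theorems.F0P3cStCharTSLevelBoxes     -- ★ p851741 (this seat) (J2) «LEVELS★»: (L1) (L3) (L6)
import HarnessLib

/-!
# F0 · P3c · line LH6 «StCharTS» — ROAD «JAC-LOC» brick (J2), sequel «LEVEL BOX SUBGROUPS★»: the Heisenberg boxes and the level pieces `K_γ ∩ N`, `K_γ ∩ T` as
# `Subgroup`s of the ambient `U′ = U(σ, Φ₃)(K)` with their carriers spelled out (the shape (J4a) «ABELIAN SANDWICH» consumes — road holder LH6-p03 (g5)'s ask 14:27:35Z)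

Cell `pub/hodgecm-mathlib`, crux H413 = `stmt-HodgeConjecture-24833` (lane `--supports … --as helper`); seat F0P3-p02 (g21); ROAD «JAC-LOC» memo
`F0/P3b/LH6-p03/g5/ROAD-JAC-LOC.v2.LH6p03g5.md` §5.  THEOREMS ONLY (no `def`: the subgroups are produced EXISTENTIALLY, by `Subgroup.map` of ★ (L6)'s box subgroup of `N` and as
the infima `K_γ ⊓ N`, `K_γ ⊓ T`); ★-only imports.  HONEST LABEL: HC_CM is proved only modulo the 7 printed citations (2 remaining: hLiu418 = `stmt-HodgeConjecture-24832`, h413 =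
`stmt-HodgeConjecture-24833`) until rung 0 closes; count-neutral bookkeeping for (J4)(J5).
* `exists_subgroup_coe_eq_image_box` (generic valued ring): `∃ S : Subgroup U′, ↑S = (↑) '' BOX(ρx, ρy)` when `v(½)ρx² ≤ ρy`, with `S ≤ N`;
* `coe_level_inf_unipotent_eq_image_box` (model): `↑(K_γ ⊓ N) = (↑) '' BOX(γ, γ)` for `γ < 1`, `v(½)γ ≤ 1` (★ (L1));
* `coe_level_inf_torus_eq` (model): `↑(K_γ ⊓ T) = {x | ∃ d, diag d = x ∧ ∀ i, v(dᵢ − 1) ≤ γ}` for `γ < 1` (★ (L3)).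

## References
* [Casselman1995] W. Casselman, *Introduction to the theory of admissible representations of p-adic reductive groups* (1995), Prop. 1.4.4.
* [vanDijk1972] G. van Dijk, Math. Ann. 199 (1972), §2.  [Rogawski1990] J. D. Rogawski, Ann. of Math. Stud. 123 (1990), §1.10 p. 9.
-/

set_option autoImplicit false
-- the mandated namespace has the single-problem summit's repeated segment (`HodgeConjecture.HodgeConjecture`)
set_option linter.dupNamespace false

noncomputable section

open Matrix ValuativeRel
open scoped MatrixGroups
open Literature.NumberTheory.Automorphic Literature.NumberTheory.Automorphic.UnitaryGroup Literature.NumberTheory.Automorphic.UnitaryGroup.HeisRing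
open Literature.NumberTheory.Rogawski1990
open Summit.HodgeConjecture.HodgeConjecture.Cruxes.H413.F0P3cStCharTSLevelBoxes

namespace Summit.HodgeConjecture.HodgeConjecture.Cruxes.H413.F0P3cStCharTSLevelBoxSubgroups

/-! ## §1 The box as a subgroup of the ambient group (generic valued ring) -/

section Box

variable {R : Type*} [CommRing R] (σ : R →+* R) (hσ : ∀ x, σ (σ x) = x) {J : Matrix (Fin 3) (Fin 3) R}
  [Invertible (2 : R)] (hJ : J = (StdForm.antidiagonal 3).over R)
  {Γ₀ : Type*} [LinearOrderedCommGroupWithZero Γ₀] (v : Valuation R Γ₀) (hv : ∀ x, v (σ x) = v x)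

include hv in
/-- **The Heisenberg box `BOX(ρx, ρy)` as a `Subgroup` of `U′ = U(σ, Φ₃)(R)`** (`v(½)·ρx² ≤ ρy`): there is `S ≤ N` with carrier `(↑) '' {n ∈ N | v(x n) ≤ ρx ∧ v(y n) ≤ ρy}` — the
`Subgroup.map` of ★ (L6)'s box subgroup of `N` along `N ↪ U′`. [cite: vanDijk1972, §2] [cite: Rogawski1990, §1.10 p. 9] -/
theorem exists_subgroup_coe_eq_image_box (ρx ρy : Γ₀) (hρ : v (⅟(2 : R)) * (ρx * ρx) ≤ ρy) :
    ∃ S : Subgroup ↥(unitaryGroupOfForm σ J), S ≤ unipotentU σ J ∧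
      (S : Set ↥(unitaryGroupOfForm σ J)) =
        (fun n : ↥(unipotentU σ J) => (n : ↥(unitaryGroupOfForm σ J))) '' {n | v (heisX σ n) ≤ ρx ∧ v (heisY σ hσ hJ n : R) ≤ ρy} := by
  obtain ⟨H, hH⟩ := exists_subgroup_box σ hσ hJ v hv ρx ρy hρ
  refine ⟨H.map (unipotentU σ J).subtype, ?_, ?_⟩
  · intro x hx
    obtain ⟨n, -, rfl⟩ := Subgroup.mem_map.1 hx
    exact n.2
  · ext x
    simp only [Subgroup.coe_map, Subgroup.coe_subtype, Set.mem_image, SetLike.mem_coe, Set.mem_setOf_eq, hH]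

omit [Invertible (2 : R)] in
/-- Membership form: `↑n ∈ S ↔ n ∈ BOX` for the subgroup of `exists_subgroup_coe_eq_image_box` (injectivity of `N ↪ U′`). [cite: vanDijk1972, §2] -/
theorem coe_mem_iff_of_coe_eq_image {S : Subgroup ↥(unitaryGroupOfForm σ J)} {B : Set ↥(unipotentU σ J)}
    (hS : (S : Set ↥(unitaryGroupOfForm σ J)) = (fun n : ↥(unipotentU σ J) => (n : ↥(unitaryGroupOfForm σ J))) '' B) (n : ↥(unipotentU σ J)) :
    (n : ↥(unitaryGroupOfForm σ J)) ∈ S ↔ n ∈ B := by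
  rw [← SetLike.mem_coe, hS, Set.mem_image]
  constructor
  · rintro ⟨m, hm, hmn⟩
    rwa [← Subtype.ext hmn]
  · exact fun hn => ⟨n, hn, rfl⟩

end Box

/-! ## §2 The level pieces `K_γ ∩ N` and `K_γ ∩ T` with their carriers (model) -/

section Levels

variable {K : Type*} [Field K] [ValuativeRel K] (σ : K →+* K) (hσ : ∀ x, σ (σ x) = x) [Invertible (2 : K)]
  {J : Matrix (Fin 3) (Fin 3) K} (hJ : J = (StdForm.antidiagonal 3).over K)
  (hσv : ∀ x, valuation K (σ x) = valuation K x)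

include hσv in
/-- **`K_γ ∩ N` IS the image of the box `BOX(γ, γ)`** (`γ < 1`, `v(½)·γ ≤ 1`; ★ (L1)): `↑(K_γ ⊓ N) = (↑) '' {n ∈ N | v(x n) ≤ γ ∧ v(y n) ≤ γ}`.
[cite: Casselman1995, Prop. 1.4.4] -/
theorem coe_level_inf_unipotent_eq_image_box {γ : ValueGroupWithZero K} (hγ : γ < 1) (h2 : valuation K (⅟(2 : K)) * γ ≤ 1) :
    (((congruenceGL 3 γ).comap (unitaryGroupOfForm σ J).subtype ⊓ (borelTriple σ J hJ).N : Subgroup ↥(unitaryGroupOfForm σ J)) :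
        Set ↥(unitaryGroupOfForm σ J)) =
      (fun n : ↥(unipotentU σ J) => (n : ↥(unitaryGroupOfForm σ J))) ''
        {n | valuation K (heisX σ n) ≤ γ ∧ valuation K (heisY σ hσ hJ n : K) ≤ γ} := by
  ext x
  rw [SetLike.mem_coe, Subgroup.mem_inf, borelTriple_N, Set.mem_image]
  constructor
  · rintro ⟨hxK, hxN⟩
    refine ⟨⟨x, hxN⟩, ?_, rfl⟩
    exact (mem_level_iff_of_mem_unipotentU σ hσ hJ hσv hγ h2 ⟨x, hxN⟩).1 hxK
  · rintro ⟨n, hn, rfl⟩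
    exact ⟨(mem_level_iff_of_mem_unipotentU σ hσ hJ hσv hγ h2 n).2 hn, n.2⟩

omit [Invertible (2 : K)] in
/-- **`K_γ ∩ T` IS the diagonal box** (`γ < 1`; ★ (L3)): `↑(K_γ ⊓ T) = {x | ∃ d, diag(d) = x ∧ ∀ i, v(d_i − 1) ≤ γ}`. [cite: Casselman1995, Prop. 1.4.4] -/
theorem coe_level_inf_torus_eq {γ : ValueGroupWithZero K} (hγ : γ < 1) :
    (((congruenceGL 3 γ).comap (unitaryGroupOfForm σ J).subtype ⊓ (borelTriple σ J hJ).M : Subgroup ↥(unitaryGroupOfForm σ J)) :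
        Set ↥(unitaryGroupOfForm σ J)) =
      {x : ↥(unitaryGroupOfForm σ J) | ∃ d : Fin 3 → Kˣ, glDiagonal 3 K d = (x : GL (Fin 3) K) ∧ ∀ i, valuation K ((d i : K) - 1) ≤ γ} := by
  ext x
  rw [SetLike.mem_coe, Subgroup.mem_inf, borelTriple_M, mem_torusU_iff, Set.mem_setOf_eq]
  constructor
  · rintro ⟨hxK, ⟨d, hd⟩⟩
    exact ⟨d, hd, (mem_level_iff_of_eq_glDiagonal σ hγ hd).1 hxK⟩
  · rintro ⟨d, hd, h⟩
    exact ⟨(mem_level_iff_of_eq_glDiagonal σ hγ hd).2 h, ⟨d, hd⟩⟩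

omit [Invertible (2 : K)] in
/-- **`K_γ ∩ T` as an abstract box-subgroup** in the shape `∃ S : Subgroup U′, ↑S = {…}` (for uniformity with §1). [cite: Casselman1995, Prop. 1.4.4] -/
theorem exists_subgroup_coe_eq_torus_box {γ : ValueGroupWithZero K} (hγ : γ < 1) :
    ∃ S : Subgroup ↥(unitaryGroupOfForm σ J), S ≤ (borelTriple σ J hJ).M ∧
      (S : Set ↥(unitaryGroupOfForm σ J)) = {x : ↥(unitaryGroupOfForm σ J) | ∃ d : Fin 3 → Kˣ, glDiagonal 3 K d = (x : GL (Fin 3) K) ∧ ∀ i, valuation K ((d i : K) - 1) ≤ γ} :=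
  ⟨(congruenceGL 3 γ).comap (unitaryGroupOfForm σ J).subtype ⊓ (borelTriple σ J hJ).M, inf_le_right, coe_level_inf_torus_eq σ hJ hγ⟩

include hσv in
/-- **`K_γ ∩ N` as an abstract box-subgroup** in the shape `∃ S : Subgroup U′, ↑S = (↑) '' BOX(γ, γ)`. [cite: Casselman1995, Prop. 1.4.4] -/
theorem exists_subgroup_coe_eq_unipotent_box {γ : ValueGroupWithZero K} (hγ : γ < 1) (h2 : valuation K (⅟(2 : K)) * γ ≤ 1) :
    ∃ S : Subgroup ↥(unitaryGroupOfForm σ J), S ≤ (borelTriple σ J hJ).N ∧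
      (S : Set ↥(unitaryGroupOfForm σ J)) =
        (fun n : ↥(unipotentU σ J) => (n : ↥(unitaryGroupOfForm σ J))) ''
          {n | valuation K (heisX σ n) ≤ γ ∧ valuation K (heisY σ hσ hJ n : K) ≤ γ} :=
  ⟨(congruenceGL 3 γ).comap (unitaryGroupOfForm σ J).subtype ⊓ (borelTriple σ J hJ).N, inf_le_right,
    coe_level_inf_unipotent_eq_image_box σ hσ hJ hσv hγ h2⟩

end Levels

end Summit.HodgeConjecture.HodgeConjecture.Cruxes.H413.F0P3cStCharTSLevelBoxSubgroups

end
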